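import Literature.Combinatorics.Sahi2008.ProvedCases
import Literature.Combinatorics.Sahi2008.Chains
import Summits.CriticalPhenomena.PercolationContinuityZ3.Theorems.PercNearOneGluingNoHeavyLowerTailSahiAbsorbedHeadBlocks

/-!
# Sahi's conjecture reduces to ANTICHAINS of events, inductively in the order — for EVERY weight

Support file (lane `prim-masterthm-p3`, generation 18; `--supports stmt-CriticalPhenomena-4575`).  Pure proofs, no definitions,
no `sorry`, standard axioms.

VALUE LEVEL, arbitrary finite preorder `α`, arbitrary nonnegative weight `μ` of mass `1` (no lattice, no FKG hypothesis except through
the assumed lower orders).  Suppose Sahi positivity holds at the orders `1 ≤ k ≤ n+1` (`SahiPositive μ k`).  Then for up-sets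
`U_0, U_1, …, U_{n+1}`:
* `sahiE_cons_setInd_nonneg_of_forall_exists`: if the head `U_0` contains `∩_{j≥1} U_j` (every point outside `U_0` is outside some `U_j`)
  then `E_{n+2}(1_{U_0}, 1_{U_1}, …, 1_{U_{n+1}}) ≥ 0`.  PROOF: `1_{U_0} = 1 − Σ_{x ∉ U_0} 1_{{x}}` (multilinearity, `sahiE_update_sum_smul`);
  `E_{n+2}(1, f) = n·E_{n+1}(f) ≥ 0` (Sahi's branching identity `sahiE_cons_of_absorbing`); and for `x ∉ U_0`, `x ∉ U_{j₀}` say, the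
  point-mass head is killed by member `j₀`, so `E_{n+2}(1_{{x}}, f) ≤ 0` by the value-level SIGN⁻ law `sahiE_setInd_cons_nonpos_of_disjoint`
  (the tail sub-families through `j₀` are Sahi-positive by the assumed lower orders).
* `sahiE_setInd_nonneg_of_comparable`: a family of `n+2` up-sets with a COMPARABLE PAIR `U_i ⊆ U_j`, `i ≠ j`, has `E_{n+2} ≥ 0`
  (symmetry `sahiE_comp_perm` puts `j` at the head).
* **`sahiPositive_of_noncontaining`**: `SahiPositive μ (n+2)` follows from `SahiPositive μ k` (`k ≤ n+1`) together with positivity on the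
  indicator families in which NO member contains the intersection of the others — SAHI'S `C_{n+2}` REDUCES TO SUCH 'ANTICHAIN' FAMILIES.
* **ORDER 3, UNCONDITIONAL** (`sahiE_three_setInd_nonneg_of_comparable`): for every FKG probability weight on a finite distributive lattice
  and up-sets `A, B, C` with a comparable pair, `E_3(1_A, 1_B, 1_C) ≥ 0` (`C_1`, `C_2` = FKG are theorems); the tree had the cumulation
  cases of Sahi's Theorem 2 (`sahiE_three_nonneg_of_isLatticeCumulation`).
The pattern-level (coefficientwise, product grids) analogue is `…SahiSlotPatternBranching`. [this work]
-/

namespace Summit.CriticalPhenomena.PercolationContinuityZ3.Theorems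

open Finset Function Equiv Equiv.Perm
open Literature.Combinatorics.Sahi2008 Literature.Combinatorics.Sahi2008.CycleForm

namespace SahiAbsorbed

section Comparable

variable {α : Type*} [Fintype α] [Preorder α] [DecidableEq α] {μ : α → ℝ} {n : ℕ}

/-- Sub-families of up-set indicators are Sahi-positive in cycle form, from `SahiPositive μ |A|`. [this work] -/
theorem cycleSum_subfamily_nonneg (hpos : ∀ k, 1 ≤ k → k ≤ n + 1 → SahiPositive μ k) (U : Fin (n + 1) → Finset α)
    (hU : ∀ j, IsUpperSet (U j : Set α)) (A : Finset (Fin (n + 1))) (hA : A.Nonempty) :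
    0 ≤ cycleSum μ (fun j : {x // x ∈ A} => setInd (U j)) := by
  set e : Fin A.card ≃ {x // x ∈ A} := (A.orderIsoOfFin rfl).toEquiv with he
  have hk1 : 1 ≤ A.card := hA.card_pos
  have hkn : A.card ≤ n + 1 := by
    calc A.card ≤ (univ : Finset (Fin (n + 1))).card := card_le_card (subset_univ _)
      _ = n + 1 := by rw [card_univ, Fintype.card_fin]
  rw [← cycleSum_comp_equiv μ e, ← sahiE_eq_cycleSum μ hk1 (fun i => setInd (U (e i)))]
  exact hpos _ hk1 hkn _ (fun i x => setInd_nonneg _ _) fun i => monotone_setInd (hU _)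

/-- **A point-mass head outside some member is nonpositive**: `x ∉ U_{j₀}` ⟹ `E_{n+2}(1_{{x}}, 1_{U_1}, …) ≤ 0`, given the lower orders.
[this work] -/
theorem sahiE_cons_single_nonpos (hμ0 : ∀ x, 0 ≤ μ x) (hpos : ∀ k, 1 ≤ k → k ≤ n + 1 → SahiPositive μ k)
    (U : Fin (n + 1) → Finset α) (hU : ∀ j, IsUpperSet (U j : Set α)) {x : α} {j₀ : Fin (n + 1)} (hx : x ∉ U j₀) :
    sahiE μ (n + 2) (Fin.cons (setInd {x}) (fun j => setInd (U j))) ≤ 0 :=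
  sahiE_setInd_cons_nonpos_of_disjoint μ hμ0 {x} U j₀ (disjoint_singleton_left.2 hx)
    fun A hA => cycleSum_subfamily_nonneg hpos U hU A ⟨j₀, hA⟩

omit [Preorder α] in
/-- Linearity of `E_{n+2}` in the head over the points of a finset: `E(1_W, f) = Σ_{x∈W} E(1_{{x}}, f)`. [this work] -/
theorem sahiE_cons_setInd_eq_sum_single (μ : α → ℝ) (W : Finset α) (f : Fin (n + 1) → α → ℝ) :
    sahiE μ (n + 2) (Fin.cons (setInd W) f) = ∑ x ∈ W, sahiE μ (n + 2) (Fin.cons (setInd {x}) f) := by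
  have hW : setInd W = ∑ x ∈ W, (1 : ℝ) • setInd ({x} : Finset α) := by
    funext y
    simp only [Finset.sum_apply, Pi.smul_apply, smul_eq_mul, one_mul, setInd_apply, mem_singleton]
    rw [Finset.sum_ite_eq W y]
  have key := sahiE_update_sum_smul μ (Fin.cons (setInd W) f) 0 W (fun _ => (1 : ℝ)) (fun x => setInd ({x} : Finset α))
  simp only [one_mul, Fin.update_cons_zero] at key
  rw [← hW] at key
  exact key

/-- **HEAD CONTAINING THE INTERSECTION OF THE TAIL ⟹ `E_{n+2} ≥ 0`** (every weight of mass one, given the lower orders). [this work] -/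
theorem sahiE_cons_setInd_nonneg_of_forall_exists (hμ0 : ∀ x, 0 ≤ μ x) (hμ1 : ∑ x, μ x = 1)
    (hpos : ∀ k, 1 ≤ k → k ≤ n + 1 → SahiPositive μ k) (U₀ : Finset α) (U : Fin (n + 1) → Finset α)
    (hU : ∀ j, IsUpperSet (U j : Set α)) (hsup : ∀ x, x ∉ U₀ → ∃ j, x ∉ U j) :
    0 ≤ sahiE μ (n + 2) (Fin.cons (setInd U₀) (fun j => setInd (U j))) := by
  -- `1_{U₀} = 1_univ - 1_{univ \ U₀}` and linearity in the head
  have hsplit : sahiE μ (n + 2) (Fin.cons (setInd U₀) (fun j => setInd (U j))) =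
      sahiE μ (n + 2) (Fin.cons (setInd (univ : Finset α)) (fun j => setInd (U j))) -
        sahiE μ (n + 2) (Fin.cons (setInd (univ \ U₀)) (fun j => setInd (U j))) := by
    rw [sahiE_cons_setInd_eq_sum_single μ univ, sahiE_cons_setInd_eq_sum_single μ (univ \ U₀),
      sahiE_cons_setInd_eq_sum_single μ U₀, eq_sub_iff_add_eq, ← sum_union disjoint_sdiff]
    rw [union_sdiff_of_subset (subset_univ _)]
  rw [hsplit, sub_nonneg]
  -- the branching term
  have hone : (setInd (univ : Finset α)) = fun _ => (1 : ℝ) := by funext x; simp [setInd_apply]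
  have hbr := sahiE_cons_of_absorbing μ n (fun _ => (1 : ℝ)) (fun j => setInd (U j)) (fun i => by funext x; simp)
  have hex : ex μ (fun _ : α => (1 : ℝ)) = 1 := by rw [ex_def]; simp [hμ1]
  rw [hex, show ((n : ℝ) + 1 - 1) = n by ring] at hbr
  have htop : sahiE μ (n + 2) (Fin.cons (setInd (univ : Finset α)) (fun j => setInd (U j))) =
      (n : ℝ) * sahiE μ (n + 1) (fun j => setInd (U j)) := by
    rw [hone]; exact hbr
  have htail : 0 ≤ sahiE μ (n + 1) (fun j => setInd (U j)) :=
    hpos (n + 1) (by omega) le_rfl _ (fun j x => setInd_nonneg _ _) fun j => monotone_setInd (hU j)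
  -- the complement term is a sum of nonpositive point-mass heads
  have hneg : sahiE μ (n + 2) (Fin.cons (setInd (univ \ U₀)) (fun j => setInd (U j))) ≤ 0 := by
    rw [sahiE_cons_setInd_eq_sum_single]
    refine sum_nonpos fun x hx => ?_
    rw [mem_sdiff] at hx
    obtain ⟨j₀, hj₀⟩ := hsup x hx.2
    exact sahiE_cons_single_nonpos hμ0 hpos U hU hj₀
  calc sahiE μ (n + 2) (Fin.cons (setInd (univ \ U₀)) (fun j => setInd (U j))) ≤ 0 := hneg
    _ ≤ sahiE μ (n + 2) (Fin.cons (setInd (univ : Finset α)) (fun j => setInd (U j))) := by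
      rw [htop]; exact mul_nonneg (Nat.cast_nonneg _) htail

/-- **A member containing the intersection of the others, in any slot.** [this work] -/
theorem sahiE_setInd_nonneg_of_inter_subset (hμ0 : ∀ x, 0 ≤ μ x) (hμ1 : ∑ x, μ x = 1)
    (hpos : ∀ k, 1 ≤ k → k ≤ n + 1 → SahiPositive μ k) (W : Fin (n + 2) → Finset α)
    (hW : ∀ j, IsUpperSet (W j : Set α)) (j : Fin (n + 2)) (hj : ∀ x, (∀ k, k ≠ j → x ∈ W k) → x ∈ W j) :
    0 ≤ sahiE μ (n + 2) (fun k => setInd (W k)) := by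
  rw [← sahiE_comp_perm μ (n + 2) (Equiv.swap 0 j) (fun k => setInd (W k))]
  have hfam : (fun k => setInd (W (Equiv.swap 0 j k))) =
      Fin.cons (setInd (W j)) (fun l : Fin (n + 1) => setInd (W (Equiv.swap 0 j l.succ))) := by
    funext k
    refine Fin.cases ?_ (fun l => ?_) k
    · simp only [swap_apply_left, Fin.cons_zero]
    · simp only [Fin.cons_succ]
  rw [hfam]
  refine sahiE_cons_setInd_nonneg_of_forall_exists hμ0 hμ1 hpos (W j) _ (fun l => hW _) fun x hx => ?_
  by_contra hcon
  push Not at hcon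
  refine hx (hj x fun k hk => ?_)
  have hk0 : Equiv.swap 0 j k ≠ 0 := by
    intro h
    have h2 := congrArg (Equiv.swap (0 : Fin (n + 2)) j) h
    rw [swap_apply_self, swap_apply_left] at h2
    exact hk h2
  obtain ⟨l, hl⟩ := Fin.exists_succ_eq.2 hk0
  have := hcon l
  rwa [hl, swap_apply_self] at this

/-- **COMPARABLE PAIR ⟹ `E_{n+2} ≥ 0`** (every weight of mass one, given the lower orders). [this work] -/
theorem sahiE_setInd_nonneg_of_comparable (hμ0 : ∀ x, 0 ≤ μ x) (hμ1 : ∑ x, μ x = 1)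
    (hpos : ∀ k, 1 ≤ k → k ≤ n + 1 → SahiPositive μ k) (W : Fin (n + 2) → Finset α)
    (hW : ∀ j, IsUpperSet (W j : Set α)) {i j : Fin (n + 2)} (hij : i ≠ j) (hWij : W i ⊆ W j) :
    0 ≤ sahiE μ (n + 2) (fun k => setInd (W k)) :=
  sahiE_setInd_nonneg_of_inter_subset hμ0 hμ1 hpos W hW j fun _ hx => hWij (hx i hij)

/-- **SAHI'S `C_{n+2}` REDUCES TO 'NON-CONTAINING' FAMILIES**: given `C_k` for `k ≤ n+1` under `μ`, Sahi positivity at order `n+2`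
follows from positivity on the indicator families of up-sets in which no member contains the intersection of the others. [this work] -/
theorem sahiPositive_of_noncontaining (hμ0 : ∀ x, 0 ≤ μ x) (hμ1 : ∑ x, μ x = 1)
    (hpos : ∀ k, 1 ≤ k → k ≤ n + 1 → SahiPositive μ k)
    (hcore : ∀ W : Fin (n + 2) → Finset α, (∀ j, IsUpperSet (W j : Set α)) →
      (∀ j, ∃ x, (∀ k, k ≠ j → x ∈ W k) ∧ x ∉ W j) → 0 ≤ sahiE μ (n + 2) (fun k => setInd (W k))) :
    SahiPositive μ (n + 2) := by
  rw [sahiPositive_iff_indicators]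
  intro W hW
  by_cases h : ∃ j, ∀ x, (∀ k, k ≠ j → x ∈ W k) → x ∈ W j
  · obtain ⟨j, hj⟩ := h
    exact sahiE_setInd_nonneg_of_inter_subset hμ0 hμ1 hpos W hW j hj
  · push Not at h
    exact hcore W hW h

end Comparable

section OrderThree

variable {α : Type*} [Fintype α] [DistribLattice α] [DecidableEq α] {μ : α → ℝ}

/-- **ORDER 3, UNCONDITIONAL**: for every FKG probability weight on a finite distributive lattice and up-sets with a comparable pair
`W_i ⊆ W_j` (`i ≠ j`), `E_3(1_{W_0}, 1_{W_1}, 1_{W_2}) ≥ 0`. [this work] -/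
theorem sahiE_three_setInd_nonneg_of_comparable (hμ : IsFKGMeasure μ) (W : Fin 3 → Finset α)
    (hW : ∀ j, IsUpperSet (W j : Set α)) {i j : Fin 3} (hij : i ≠ j) (hWij : W i ⊆ W j) :
    0 ≤ sahiE μ 3 (fun k => setInd (W k)) := by
  refine sahiE_setInd_nonneg_of_comparable (n := 1) hμ.nonneg hμ.sum_eq_one (fun k hk1 hk2 => ?_) W hW hij hWij
  interval_cases k
  · exact sahiPositive_one hμ.nonneg
  · exact sahiPositive_two hμ

/-- **ORDER 3, a member containing the meet of the other two** (e.g. `C ⊇ A ∩ B`): `E_3(1_A, 1_B, 1_C) ≥ 0` for every FKG weight. [this work] -/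
theorem sahiE_three_setInd_nonneg_of_inter_subset (hμ : IsFKGMeasure μ) (W : Fin 3 → Finset α)
    (hW : ∀ j, IsUpperSet (W j : Set α)) (j : Fin 3) (hj : ∀ x, (∀ k, k ≠ j → x ∈ W k) → x ∈ W j) :
    0 ≤ sahiE μ 3 (fun k => setInd (W k)) := by
  refine sahiE_setInd_nonneg_of_inter_subset (n := 1) hμ.nonneg hμ.sum_eq_one (fun k hk1 hk2 => ?_) W hW j hj
  interval_cases k
  · exact sahiPositive_one hμ.nonneg
  · exact sahiPositive_two hμ

end OrderThree

end SahiAbsorbed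

end Summit.CriticalPhenomena.PercolationContinuityZ3.Theorems
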